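import Literature.MathematicalPhysics.QuantumManyBody.BoseGasCatStates
import Mathlib.MeasureTheory.Integral.Pi
import HarnessLib

/-!
# One-particle Dirichlet orbitals of a box from a one-dimensional profile, with explicit constants

Topic `Literature/MathematicalPhysics/QuantumManyBody` (grouping namespace `BoseGas`; carriers of
`BoseEinsteinCondensation.lean`: `Space = ℝ³`, `Config 1`, `TrialState 1 L`, `energy`). Given a
one-dimensional profile `b : ℝ → [0, 1]` with continuous derivative `b'`, vanishing off
`(0, 1)`, with mass `∫ b² = m > 0` and kinetic constant `∫ b'² = κ`, the normalised product
`ψ(x) = m^{-3/2} b(x₁) b(x₂) b(x₃)` is a one-particle Dirichlet trial state of the unit cube with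
`∫|∇ψ|² = 3κ/m` (Fubini over the three coordinates, `integral_fin_nat_prod_volume_eq_prod`,
after identifying Lebesgue measure on `EuclideanSpace ℝ (Fin 3)` with the product measure) and
`sup |ψ|² ≤ m⁻³`; dilating to the box `Λ_L` (`TrialState.dilate`, `TrialState.energy_dilate`):

* `exists_productOrbital` — for `L > 0` there is `Θ : TrialState 1 L` with
  `energy 0 Θ ≤ (3κ/m)/L²` and `|Θ(Y)|² ≤ m⁻³/L³` for every `Y`.

Used with the flat-top profile of `BoseGasFlatTopProfile.lean` (`m = 11/16`, `κ = π²`) to insert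
a particle into an `N`-body state at explicit cost. No definitions: the intermediate objects
(orbital `o`, partial derivatives `od`, constant `c`, wave function `w`) are section variables
characterised by hypotheses, instantiated in the final theorem. Elementary; tagged folklore.
-/

noncomputable section

namespace Literature.MathematicalPhysics.QuantumManyBody.BoseGas

open _root_.MeasureTheory _root_.Filter _root_.Set _root_.Real
open scoped ENNReal NNReal Topology

namespace ProductOrbital

/-! ### Products of coordinate functions on `ℝ³` -/

/-- **Fubini for coordinate products on `ℝ³`**: `∫ g₀(x₁)g₁(x₂)g₂(x₃) dx = (∫g₀)(∫g₁)(∫g₂)`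
(Lebesgue measure on `EuclideanSpace ℝ (Fin 3)` is the product measure). [folklore] -/
theorem integral_coord_prod (g₀ g₁ g₂ : ℝ → ℝ) :
    ∫ x : Space, g₀ (x 0) * g₁ (x 1) * g₂ (x 2) = (∫ t, g₀ t) * (∫ t, g₁ t) * ∫ t, g₂ t := by
  have hmp := EuclideanSpace.volume_preserving_symm_measurableEquiv_toLp (Fin 3)
  have h := hmp.integral_comp' (f := (MeasurableEquiv.toLp 2 (Fin 3 → ℝ)).symm)
    (fun y : Fin 3 → ℝ => g₀ (y 0) * g₁ (y 1) * g₂ (y 2))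
  simp only [MeasurableEquiv.coe_toLp_symm] at h
  rw [h]
  have h2 := integral_fin_nat_prod_volume_eq_prod (𝕜 := ℝ) (E := fun _ : Fin 3 => ℝ)
    ![g₀, g₁, g₂]
  simp only [Fin.prod_univ_three, Matrix.cons_val_zero, Matrix.cons_val_one,
    Matrix.cons_val] at h2
  exact h2

/-- Integrability of coordinate products on `ℝ³`. [folklore] -/
theorem integrable_coord_prod {g₀ g₁ g₂ : ℝ → ℝ} (h₀ : Integrable g₀) (h₁ : Integrable g₁)
    (h₂ : Integrable g₂) :
    Integrable fun x : Space => g₀ (x 0) * g₁ (x 1) * g₂ (x 2) := by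
  have hmp := EuclideanSpace.volume_preserving_symm_measurableEquiv_toLp (Fin 3)
  have hi : Integrable fun y : Fin 3 → ℝ => ∏ i, (![g₀, g₁, g₂] : Fin 3 → ℝ → ℝ) i (y i) :=
    Integrable.fin_nat_prod fun i => by
      fin_cases i
      · simpa using h₀
      · simpa using h₁
      · simpa using h₂
  have h := (hmp.integrable_comp_emb
    (MeasurableEquiv.toLp 2 (Fin 3 → ℝ)).symm.measurableEmbedding).2 hi
  simp only [MeasurableEquiv.coe_toLp_symm, Function.comp_def, Fin.prod_univ_three,
    Matrix.cons_val_zero, Matrix.cons_val_one, Matrix.cons_val] at h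
  exact h

/-! ### The product orbital of a one-dimensional profile -/

section Profile

variable {b b' : ℝ → ℝ} {m κ c : ℝ} {o : Space → ℝ} {od : Fin 3 → Space → ℝ}
  {w : Config 1 → ℂ}

/-- A profile with a continuous derivative is `C¹`. [folklore] -/
theorem contDiff_profile (hd : ∀ t, HasDerivAt b (b' t) t) (hb' : Continuous b') :
    ContDiff ℝ 1 b := by
  refine contDiff_one_iff_deriv.2 ⟨fun t => (hd t).differentiableAt, ?_⟩
  rwa [show deriv b = b' from funext fun t => (hd t).deriv]

/-- `0 ≤ o ≤ 1` for the orbital `o(x) = b(x₁)b(x₂)b(x₃)` of a profile `0 ≤ b ≤ 1`. [folklore] -/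
theorem orb_mem (h01 : ∀ t, 0 ≤ b t ∧ b t ≤ 1) (ho : ∀ x, o x = b (x 0) * b (x 1) * b (x 2))
    (x : Space) : 0 ≤ o x ∧ o x ≤ 1 := by
  have h0 := h01 (x 0)
  have h1 := h01 (x 1)
  have h2 := h01 (x 2)
  rw [ho]
  exact ⟨mul_nonneg (mul_nonneg h0.1 h1.1) h2.1,
    mul_le_one₀ (mul_le_one₀ h0.2 h1.1 h1.2) h2.1 h2.2⟩

/-- `o` vanishes off the open unit cube when `b` vanishes off `(0, 1)`. [folklore] -/
theorem orb_eq_zero_of_not_mem (hsupp : ∀ t, t ∉ Ioo (0 : ℝ) 1 → b t = 0)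
    (ho : ∀ x, o x = b (x 0) * b (x 1) * b (x 2)) {x : Space} (hx : x ∉ box 1) : o x = 0 := by
  simp only [box, Set.mem_setOf_eq, not_forall] at hx
  obtain ⟨k, hk⟩ := hx
  have hb : b (x k) = 0 := hsupp _ hk
  rw [ho]
  fin_cases k
  · simp only [Fin.zero_eta] at hb; rw [hb]; ring
  · simp only [Fin.mk_one] at hb; rw [hb]; ring
  · rw [show (2 : Fin 3) = ⟨2, by norm_num⟩ from rfl, hb]; ring

/-- The coordinate factors: `D(b ∘ xₖ)(x) = b'(xₖ) · (w ↦ wₖ)`. [folklore] -/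
theorem hasFDerivAt_coord (hd : ∀ t, HasDerivAt b (b' t) t) (x : Space) (k : Fin 3) :
    HasFDerivAt (fun x : Space => b (x k))
      (b' (x k) • (EuclideanSpace.proj k : Space →L[ℝ] ℝ)) x := by
  have h := (hd (x k)).comp_hasFDerivAt x (EuclideanSpace.proj k : Space →L[ℝ] ℝ).hasFDerivAt
  exact h

/-- The derivative of the orbital (Leibniz rule for the three factors). [folklore] -/
theorem hasFDerivAt_orb (hd : ∀ t, HasDerivAt b (b' t) t)
    (ho : ∀ x, o x = b (x 0) * b (x 1) * b (x 2)) (x : Space) :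
    HasFDerivAt o
      ((b (x 0) * b (x 1)) • (b' (x 2) • (EuclideanSpace.proj 2 : Space →L[ℝ] ℝ)) +
        b (x 2) • (b (x 0) • (b' (x 1) • (EuclideanSpace.proj 1 : Space →L[ℝ] ℝ)) +
          b (x 1) • (b' (x 0) • (EuclideanSpace.proj 0 : Space →L[ℝ] ℝ)))) x := by
  rw [show o = fun x => b (x 0) * b (x 1) * b (x 2) from funext ho]
  exact ((hasFDerivAt_coord hd x 0).mul (hasFDerivAt_coord hd x 1)).mul
    (hasFDerivAt_coord hd x 2)

/-- The orbital is `C¹`. [folklore] -/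
theorem contDiff_orb (hd : ∀ t, HasDerivAt b (b' t) t) (hb' : Continuous b')
    (ho : ∀ x, o x = b (x 0) * b (x 1) * b (x 2)) : ContDiff ℝ 1 o := by
  rw [show o = fun x => b (x 0) * b (x 1) * b (x 2) from funext ho]
  exact (((contDiff_profile hd hb').comp
    (EuclideanSpace.proj (0 : Fin 3) : Space →L[ℝ] ℝ).contDiff).mul
    ((contDiff_profile hd hb').comp
      (EuclideanSpace.proj (1 : Fin 3) : Space →L[ℝ] ℝ).contDiff)).mul
    ((contDiff_profile hd hb').comp (EuclideanSpace.proj (2 : Fin 3) : Space →L[ℝ] ℝ).contDiff)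

/-- `Do(x) eₖ = ∂ₖ o(x)`, the `k`-th factor differentiated. [folklore] -/
theorem fderiv_orb_single (hd : ∀ t, HasDerivAt b (b' t) t)
    (ho : ∀ x, o x = b (x 0) * b (x 1) * b (x 2))
    (hod : ∀ k x, od k x = (if k = 0 then b' (x 0) else b (x 0)) *
      (if k = 1 then b' (x 1) else b (x 1)) * (if k = 2 then b' (x 2) else b (x 2)))
    (x : Space) (k : Fin 3) : fderiv ℝ o x (EuclideanSpace.single k 1) = od k x := by
  rw [(hasFDerivAt_orb hd ho x).fderiv, hod]
  fin_cases k <;> simp <;> ring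

/-- `∂ₖ o` is continuous. [folklore] -/
theorem continuous_orbD (hd : ∀ t, HasDerivAt b (b' t) t) (hb' : Continuous b')
    (hod : ∀ k x, od k x = (if k = 0 then b' (x 0) else b (x 0)) *
      (if k = 1 then b' (x 1) else b (x 1)) * (if k = 2 then b' (x 2) else b (x 2)))
    (k : Fin 3) : Continuous (od k) := by
  have hb : ∀ j : Fin 3, Continuous fun x : Space => b (x j) := fun j =>
    (contDiff_profile hd hb').continuous.comp (EuclideanSpace.proj j : Space →L[ℝ] ℝ).continuous
  have hD : ∀ j : Fin 3, Continuous fun x : Space => b' (x j) := fun j =>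
    hb'.comp (EuclideanSpace.proj j : Space →L[ℝ] ℝ).continuous
  have hi : ∀ j : Fin 3, Continuous fun x : Space => if k = j then b' (x j) else b (x j) := by
    intro j
    by_cases h : k = j
    · simp only [h, if_true]; exact hD j
    · simp only [h, if_false]; exact hb j
  rw [show od k = _ from funext (hod k)]
  exact ((hi 0).mul (hi 1)).mul (hi 2)

/-- **Mass of the orbital**: `∫ o² = m³`. [folklore] -/
theorem integral_orb_sq (hbm : ∫ t, b t ^ 2 = m)
    (ho : ∀ x, o x = b (x 0) * b (x 1) * b (x 2)) : ∫ x : Space, o x ^ 2 = m ^ 3 := by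
  have h : ∀ x : Space, o x ^ 2 = b (x 0) ^ 2 * b (x 1) ^ 2 * b (x 2) ^ 2 := fun x => by
    rw [ho]; ring
  simp_rw [h]
  rw [integral_coord_prod (fun t => b t ^ 2) (fun t => b t ^ 2) (fun t => b t ^ 2), hbm]
  ring

/-- `o²` is integrable. [folklore] -/
theorem integrable_orb_sq (hi : Integrable fun t => b t ^ 2)
    (ho : ∀ x, o x = b (x 0) * b (x 1) * b (x 2)) : Integrable fun x : Space => o x ^ 2 := by
  have h : ∀ x : Space, o x ^ 2 = b (x 0) ^ 2 * b (x 1) ^ 2 * b (x 2) ^ 2 := fun x => by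
    rw [ho]; ring
  simp_rw [h]
  exact integrable_coord_prod hi hi hi

/-- **Kinetic constants of the orbital**: `∫ (∂ₖ o)² = κ m²` for each `k`. [folklore] -/
theorem integral_orbD_sq (hbm : ∫ t, b t ^ 2 = m) (hbκ : ∫ t, b' t ^ 2 = κ)
    (hod : ∀ k x, od k x = (if k = 0 then b' (x 0) else b (x 0)) *
      (if k = 1 then b' (x 1) else b (x 1)) * (if k = 2 then b' (x 2) else b (x 2)))
    (k : Fin 3) : ∫ x : Space, od k x ^ 2 = κ * m ^ 2 := by
  simp_rw [hod]
  fin_cases k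
  · simp only [Fin.zero_eta, Fin.isValue, if_true, show (0 : Fin 3) ≠ 1 by decide,
      show (0 : Fin 3) ≠ 2 by decide, if_false]
    simp_rw [show ∀ x : Space, (b' (x 0) * b (x 1) * b (x 2)) ^ 2 =
      b' (x 0) ^ 2 * b (x 1) ^ 2 * b (x 2) ^ 2 from fun x => by ring]
    rw [integral_coord_prod (fun t => b' t ^ 2) (fun t => b t ^ 2) (fun t => b t ^ 2), hbm, hbκ]
    ring
  · simp only [Fin.mk_one, Fin.isValue, if_true, show (1 : Fin 3) ≠ 0 by decide,
      show (1 : Fin 3) ≠ 2 by decide, if_false]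
    simp_rw [show ∀ x : Space, (b (x 0) * b' (x 1) * b (x 2)) ^ 2 =
      b (x 0) ^ 2 * b' (x 1) ^ 2 * b (x 2) ^ 2 from fun x => by ring]
    rw [integral_coord_prod (fun t => b t ^ 2) (fun t => b' t ^ 2) (fun t => b t ^ 2), hbm, hbκ]
    ring
  · simp only [show (⟨2, by norm_num⟩ : Fin 3) = 2 from rfl, Fin.isValue, if_true,
      show (2 : Fin 3) ≠ 0 by decide, show (2 : Fin 3) ≠ 1 by decide, if_false]
    simp_rw [show ∀ x : Space, (b (x 0) * b (x 1) * b' (x 2)) ^ 2 =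
      b (x 0) ^ 2 * b (x 1) ^ 2 * b' (x 2) ^ 2 from fun x => by ring]
    rw [integral_coord_prod (fun t => b t ^ 2) (fun t => b t ^ 2) (fun t => b' t ^ 2), hbm, hbκ]
    ring

/-- `(∂ₖ o)²` is integrable. [folklore] -/
theorem integrable_orbD_sq (hi : Integrable fun t => b t ^ 2) (hi' : Integrable fun t => b' t ^ 2)
    (hod : ∀ k x, od k x = (if k = 0 then b' (x 0) else b (x 0)) *
      (if k = 1 then b' (x 1) else b (x 1)) * (if k = 2 then b' (x 2) else b (x 2)))
    (k : Fin 3) : Integrable fun x : Space => od k x ^ 2 := by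
  simp_rw [hod]
  fin_cases k
  · simp only [Fin.zero_eta, Fin.isValue, if_true, show (0 : Fin 3) ≠ 1 by decide,
      show (0 : Fin 3) ≠ 2 by decide, if_false]
    simp_rw [show ∀ x : Space, (b' (x 0) * b (x 1) * b (x 2)) ^ 2 =
      b' (x 0) ^ 2 * b (x 1) ^ 2 * b (x 2) ^ 2 from fun x => by ring]
    exact integrable_coord_prod hi' hi hi
  · simp only [Fin.mk_one, Fin.isValue, if_true, show (1 : Fin 3) ≠ 0 by decide,
      show (1 : Fin 3) ≠ 2 by decide, if_false]
    simp_rw [show ∀ x : Space, (b (x 0) * b' (x 1) * b (x 2)) ^ 2 =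
      b (x 0) ^ 2 * b' (x 1) ^ 2 * b (x 2) ^ 2 from fun x => by ring]
    exact integrable_coord_prod hi hi' hi
  · simp only [show (⟨2, by norm_num⟩ : Fin 3) = 2 from rfl, Fin.isValue, if_true,
      show (2 : Fin 3) ≠ 0 by decide, show (2 : Fin 3) ≠ 1 by decide, if_false]
    simp_rw [show ∀ x : Space, (b (x 0) * b (x 1) * b' (x 2)) ^ 2 =
      b (x 0) ^ 2 * b (x 1) ^ 2 * b' (x 2) ^ 2 from fun x => by ring]
    exact integrable_coord_prod hi hi hi'

/-! ### The normalised wave function `w(Y) = c · o(Y 0)`, `c² = m⁻³`, on `Config 1` -/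

/-- The derivative of the wave function (chain rule through the only particle). [folklore] -/
theorem hasFDerivAt_wave (hd : ∀ t, HasDerivAt b (b' t) t) (hb' : Continuous b')
    (ho : ∀ x, o x = b (x 0) * b (x 1) * b (x 2)) (hw : ∀ Y, w Y = ((c * o (Y 0) : ℝ) : ℂ))
    (Y : Config 1) :
    HasFDerivAt w (Complex.ofRealCLM.comp (c • ((fderiv ℝ o (Y 0)).comp
      (ContinuousLinearMap.proj (R := ℝ) (φ := fun _ : Fin 1 => Space) 0)))) Y := by
  have h1 : HasFDerivAt (fun Y : Config 1 => o (Y 0)) ((fderiv ℝ o (Y 0)).comp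
      (ContinuousLinearMap.proj (R := ℝ) (φ := fun _ : Fin 1 => Space) 0)) Y :=
    (((contDiff_orb hd hb' ho).differentiable one_ne_zero) _).hasFDerivAt.comp Y
      (ContinuousLinearMap.proj (R := ℝ) (φ := fun _ : Fin 1 => Space) 0).hasFDerivAt
  rw [show w = fun Y => ((c * o (Y 0) : ℝ) : ℂ) from funext hw]
  exact Complex.ofRealCLM.hasFDerivAt.comp Y (h1.const_smul c)

/-- The wave function is `C¹`. [folklore] -/
theorem contDiff_wave (hd : ∀ t, HasDerivAt b (b' t) t) (hb' : Continuous b')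
    (ho : ∀ x, o x = b (x 0) * b (x 1) * b (x 2)) (hw : ∀ Y, w Y = ((c * o (Y 0) : ℝ) : ℂ)) :
    ContDiff ℝ 1 w := by
  rw [show w = fun Y => ((c * o (Y 0) : ℝ) : ℂ) from funext hw]
  exact Complex.ofRealCLM.contDiff.comp (contDiff_const.mul ((contDiff_orb hd hb' ho).comp
    (contDiff_apply ℝ Space 0)))

/-- **Kinetic density of the wave function**: `|∇w|²(Y) = ∑ₖ (c ∂ₖo(Y 0))²`. [folklore] -/
theorem kineticDensity_wave (hd : ∀ t, HasDerivAt b (b' t) t) (hb' : Continuous b')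
    (ho : ∀ x, o x = b (x 0) * b (x 1) * b (x 2))
    (hod : ∀ k x, od k x = (if k = 0 then b' (x 0) else b (x 0)) *
      (if k = 1 then b' (x 1) else b (x 1)) * (if k = 2 then b' (x 2) else b (x 2)))
    (hw : ∀ Y, w Y = ((c * o (Y 0) : ℝ) : ℂ)) (Y : Config 1) :
    kineticDensity w Y = ∑ k : Fin 3, ENNReal.ofReal ((c * od k (Y 0)) ^ 2) := by
  unfold kineticDensity
  rw [Fin.sum_univ_one]
  refine Finset.sum_congr rfl fun k _ => ?_
  rw [(hasFDerivAt_wave hd hb' ho hw Y).fderiv, ← ennnorm_real_sq]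
  congr 2
  simp only [ContinuousLinearMap.coe_comp, Function.comp_apply, ContinuousLinearMap.proj_apply,
    Pi.single_eq_same, _root_.smul_apply, fderiv_orb_single hd ho hod, smul_eq_mul,
    Complex.ofRealCLM_apply]

/-- **Normalisation**: `∫ |w|² = c² · m³ = 1` for `c² = m⁻³`. [folklore] -/
theorem lintegral_wave_sq (hm : 0 < m) (hbm : ∫ t, b t ^ 2 = m) (hi : Integrable fun t => b t ^ 2)
    (ho : ∀ x, o x = b (x 0) * b (x 1) * b (x 2)) (hc : c ^ 2 = m⁻¹ ^ 3)
    (hw : ∀ Y, w Y = ((c * o (Y 0) : ℝ) : ℂ)) : ∫⁻ Y : Config 1, (‖w Y‖₊ : ℝ≥0∞) ^ 2 = 1 := by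
  simp_rw [hw]
  refine (lintegral_funUnique_comp fun y : Space => (‖((c * o y : ℝ) : ℂ)‖₊ : ℝ≥0∞) ^ 2).trans ?_
  simp_rw [ennnorm_real_sq]
  rw [← ofReal_integral_eq_lintegral_ofReal (((integrable_orb_sq hi ho).const_mul (c ^ 2)).congr
    (ae_of_all _ fun y => by ring)) (ae_of_all _ fun y => sq_nonneg _)]
  have h : ∫ y : Space, (c * o y) ^ 2 = c ^ 2 * ∫ y : Space, o y ^ 2 := by
    rw [← MeasureTheory.integral_const_mul]
    exact integral_congr_ae (ae_of_all _ fun y => by ring)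
  rw [h, integral_orb_sq hbm ho, hc, ← mul_pow, inv_mul_cancel₀ hm.ne', one_pow,
    ENNReal.ofReal_one]

/-- **Dirichlet condition**: the wave function vanishes off `Λ_1^1`. [folklore] -/
theorem wave_eq_zero (hsupp : ∀ t, t ∉ Ioo (0 : ℝ) 1 → b t = 0)
    (ho : ∀ x, o x = b (x 0) * b (x 1) * b (x 2)) (hw : ∀ Y, w Y = ((c * o (Y 0) : ℝ) : ℂ))
    (Y : Config 1) (hY : Y ∉ boxN 1 1) : w Y = 0 := by
  have h : Y 0 ∉ box 1 := by
    intro h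
    apply hY
    intro i
    rw [Subsingleton.elim i 0]
    exact h
  rw [hw, orb_eq_zero_of_not_mem hsupp ho h, mul_zero, Complex.ofReal_zero]

/-- Bose symmetry is vacuous for one particle. [folklore] -/
theorem wave_symm (hw : ∀ Y, w Y = ((c * o (Y 0) : ℝ) : ℂ)) (σ : Equiv.Perm (Fin 1))
    (Y : Config 1) : w (Y ∘ σ) = w Y := by
  rw [hw, hw, Function.comp_apply, Subsingleton.elim (σ 0) 0]

/-- **Pointwise bound**: `|w(Y)|² ≤ m⁻³` (`0 ≤ o ≤ 1`, `c² = m⁻³`). [folklore] -/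
theorem normSq_wave_le (h01 : ∀ t, 0 ≤ b t ∧ b t ≤ 1)
    (ho : ∀ x, o x = b (x 0) * b (x 1) * b (x 2)) (hc : c ^ 2 = m⁻¹ ^ 3) (hm : 0 < m)
    (hw : ∀ Y, w Y = ((c * o (Y 0) : ℝ) : ℂ)) (Y : Config 1) :
    (‖w Y‖₊ : ℝ≥0∞) ^ 2 ≤ ENNReal.ofReal (m⁻¹ ^ 3) := by
  rw [hw, ennnorm_real_sq]
  refine ENNReal.ofReal_le_ofReal ?_
  rw [mul_pow, hc]
  have h := orb_mem h01 ho (Y 0)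
  have h2 : o (Y 0) ^ 2 ≤ 1 := pow_le_one₀ h.1 h.2
  have h3 : (0 : ℝ) ≤ m⁻¹ ^ 3 := by positivity
  nlinarith

/-- `∫ c² (∂ₖo)² = κ/m` through the one-particle configuration space. [folklore] -/
theorem lintegral_orbD_term (hm : 0 < m) (hbm : ∫ t, b t ^ 2 = m) (hbκ : ∫ t, b' t ^ 2 = κ)
    (hi : Integrable fun t => b t ^ 2) (hi' : Integrable fun t => b' t ^ 2)
    (hod : ∀ k x, od k x = (if k = 0 then b' (x 0) else b (x 0)) *
      (if k = 1 then b' (x 1) else b (x 1)) * (if k = 2 then b' (x 2) else b (x 2)))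
    (hc : c ^ 2 = m⁻¹ ^ 3) (k : Fin 3) :
    ∫⁻ Y : Config 1, ENNReal.ofReal ((c * od k (Y 0)) ^ 2) = ENNReal.ofReal (κ / m) := by
  refine (lintegral_funUnique_comp fun y : Space => ENNReal.ofReal ((c * od k y) ^ 2)).trans ?_
  rw [← ofReal_integral_eq_lintegral_ofReal (((integrable_orbD_sq hi hi' hod k).const_mul
    (c ^ 2)).congr (ae_of_all _ fun y => by ring)) (ae_of_all _ fun y => sq_nonneg _)]
  congr 1
  have h : ∫ y : Space, (c * od k y) ^ 2 = c ^ 2 * ∫ y : Space, od k y ^ 2 := by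
    rw [← MeasureTheory.integral_const_mul]
    exact integral_congr_ae (ae_of_all _ fun y => by ring)
  rw [h, integral_orbD_sq hbm hbκ hod, hc]
  field_simp

/-- **Kinetic energy of the normalised product state**: `𝓔₀ = 3κ/m` (`≤` recorded), for the
state assembled from the wave function `w` and its four certificates. [folklore] -/
theorem energy_state_le (hd : ∀ t, HasDerivAt b (b' t) t) (hb' : Continuous b') (hm : 0 < m)
    (hbm : ∫ t, b t ^ 2 = m) (hbκ : ∫ t, b' t ^ 2 = κ) (hi : Integrable fun t => b t ^ 2)
    (hi' : Integrable fun t => b' t ^ 2)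
    (ho : ∀ x, o x = b (x 0) * b (x 1) * b (x 2))
    (hod : ∀ k x, od k x = (if k = 0 then b' (x 0) else b (x 0)) *
      (if k = 1 then b' (x 1) else b (x 1)) * (if k = 2 then b' (x 2) else b (x 2)))
    (hc : c ^ 2 = m⁻¹ ^ 3) (hw : ∀ Y, w Y = ((c * o (Y 0) : ℝ) : ℂ))
    (h₁ : ContDiff ℝ 1 w) (h₂ : ∀ Y, Y ∉ boxN 1 1 → w Y = 0)
    (h₃ : ∀ (σ : Equiv.Perm (Fin 1)) (Y : Config 1), w (Y ∘ σ) = w Y)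
    (h₄ : ∫⁻ Y : Config 1, (‖w Y‖₊ : ℝ≥0∞) ^ 2 = 1) :
    energy 0 (TrialState.mk w h₁ h₂ h₃ h₄ : TrialState 1 1) ≤ ENNReal.ofReal (3 * κ / m) := by
  unfold energy
  simp only [interaction_zeroPotential, zero_mul, add_zero, kineticDensity_wave hd hb' ho hod hw]
  have hmeas : ∀ k : Fin 3, Measurable fun Y : Config 1 => ENNReal.ofReal ((c * od k (Y 0)) ^ 2) :=
    fun k => ((continuous_const.mul ((continuous_orbD hd hb' hod k).comp
      (continuous_apply 0))).pow 2).measurable.ennreal_ofReal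
  rw [lintegral_finsetSum _ fun k _ => hmeas k]
  simp only [lintegral_orbD_term hm hbm hbκ hi hi' hod hc, Finset.sum_const, Finset.card_univ,
    Fintype.card_fin, nsmul_eq_mul, Nat.cast_ofNat]
  rw [show (3 : ℝ≥0∞) = ENNReal.ofReal 3 by norm_num, ← ENNReal.ofReal_mul (by norm_num)]
  exact le_of_eq (by congr 1; ring)

end Profile

/-! ### Scaling to the box `Λ_L` -/

/-- The wave function of a length-cast state. [folklore] -/
theorem castLen_ψ {N : ℕ} {L L' : ℝ} (h : L = L') (Ψ : TrialState N L) :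
    (TrialState.castLen h Ψ).ψ = Ψ.ψ := by
  subst h; rfl

/-- `dim (ℝ³)¹ = 3`. [folklore] -/
theorem finrank_config_one : Module.finrank ℝ (Config 1) = 3 := by
  rw [Module.finrank_pi_fintype]; simp

/-- **Product orbitals of the box `Λ_L` with explicit constants.** For a one-dimensional profile
`b : ℝ → [0,1]` with continuous derivative `b'`, vanishing off `(0,1)`, of mass `∫b² = m > 0`
and kinetic constant `∫b'² = κ`, and every `L > 0`, there is a one-particle Dirichlet trial
state `Θ` of `Λ_L` with `𝓔₀[Θ] ≤ (3κ/m)/L²` and `|Θ(Y)|² ≤ m⁻³/L³` for all `Y` (the normalised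
product `m^{-3/2}∏b(xₖ)` of the unit cube, dilated by `L`). [folklore] -/
theorem exists_productOrbital {b b' : ℝ → ℝ} {m κ : ℝ} (hd : ∀ t, HasDerivAt b (b' t) t)
    (hb' : Continuous b') (h01 : ∀ t, 0 ≤ b t ∧ b t ≤ 1)
    (hsupp : ∀ t, t ∉ Ioo (0 : ℝ) 1 → b t = 0) (hm : 0 < m) (hbm : ∫ t, b t ^ 2 = m)
    (hbκ : ∫ t, b' t ^ 2 = κ) (hi : Integrable fun t => b t ^ 2)
    (hi' : Integrable fun t => b' t ^ 2) {L : ℝ} (hL : 0 < L) :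
    ∃ Θ : TrialState 1 L, energy 0 Θ ≤ ENNReal.ofReal (3 * κ / m / L ^ 2) ∧
      ∀ Y : Config 1, (‖Θ.ψ Y‖₊ : ℝ≥0∞) ^ 2 ≤ ENNReal.ofReal (m⁻¹ ^ 3 / L ^ 3) := by
  have hκ : 0 ≤ κ := by rw [← hbκ]; exact integral_nonneg fun t => sq_nonneg _
  -- the intermediate objects, as local definitions
  set o : Space → ℝ := fun x => b (x 0) * b (x 1) * b (x 2) with ho_def
  have ho : ∀ x : Space, o x = b (x 0) * b (x 1) * b (x 2) := fun x => rfl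
  set od : Fin 3 → Space → ℝ := fun k x =>
    (if k = 0 then b' (x 0) else b (x 0)) * (if k = 1 then b' (x 1) else b (x 1)) *
      (if k = 2 then b' (x 2) else b (x 2)) with hod_def
  have hod : ∀ (k : Fin 3) (x : Space), od k x =
      (if k = 0 then b' (x 0) else b (x 0)) * (if k = 1 then b' (x 1) else b (x 1)) *
        (if k = 2 then b' (x 2) else b (x 2)) := fun k x => rfl
  set cst : ℝ := Real.sqrt (m⁻¹ ^ 3) with hcst_def
  have hc : cst ^ 2 = m⁻¹ ^ 3 := Real.sq_sqrt (by positivity)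
  set w : Config 1 → ℂ := fun Y => ((cst * o (Y 0) : ℝ) : ℂ) with hw_def
  have hw : ∀ Y : Config 1, w Y = ((cst * o (Y 0) : ℝ) : ℂ) := fun Y => rfl
  have h₁ := contDiff_wave hd hb' ho hw
  have h₂ := wave_eq_zero hsupp ho hw
  have h₃ := wave_symm hw
  have h₄ := lintegral_wave_sq hm hbm hi ho hc hw
  set β : TrialState 1 1 := TrialState.mk w h₁ h₂ h₃ h₄ with hβ
  refine ⟨TrialState.castLen (mul_one L) (TrialState.dilate β hL), ?_, fun Y => ?_⟩
  · rw [TrialState.energy_castLen]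
    have h := TrialState.energy_dilate 0 β hL
    rw [scalePotential_zero] at h
    rw [h]
    calc ENNReal.ofReal (L ^ 2)⁻¹ * energy 0 β
        ≤ ENNReal.ofReal (L ^ 2)⁻¹ * ENNReal.ofReal (3 * κ / m) := by
          gcongr
          exact energy_state_le hd hb' hm hbm hbκ hi hi' ho hod hc hw h₁ h₂ h₃ h₄
      _ = ENNReal.ofReal (3 * κ / m / L ^ 2) := by
          rw [← ENNReal.ofReal_mul (by positivity)]; congr 1; ring
  · rw [castLen_ψ, TrialState.dilate_ψ, ennorm_real_mul_sq _ (Real.sqrt_nonneg _),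
      finrank_config_one, Real.sq_sqrt (by positivity)]
    calc ENNReal.ofReal (L ^ 3)⁻¹ * (‖β.ψ (L⁻¹ • Y)‖₊ : ℝ≥0∞) ^ 2
        ≤ ENNReal.ofReal (L ^ 3)⁻¹ * ENNReal.ofReal (m⁻¹ ^ 3) := by
          gcongr; exact normSq_wave_le h01 ho hc hm hw _
      _ = ENNReal.ofReal (m⁻¹ ^ 3 / L ^ 3) := by
          rw [← ENNReal.ofReal_mul (by positivity)]; congr 1; ring

end ProductOrbital

end Literature.MathematicalPhysics.QuantumManyBody.BoseGas

end
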